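import Summits.HodgeConjecture.HodgeConjecture.Theorems.F0P6aSpecOrgansUTwoRoofLegs
import HarnessLib

/-!
# `F0P6aSpecOrgansURoofFlat` — ★ RE-HOME of `Lines/F0_P6a_SpecOrgansU.lean` (tree sha16 c0cd5fc2e87636d7, 1347 l.), PART 4 of 5 — tree lines :972–:1268
See PART 1 `Theorems/F0P6aSpecOrgansUBlockJ.lean` for the full ★ re-home header and the original module docstring (verbatim there).  Same namespace (every
fully-qualified name unchanged); the scopes open at the cut are re-opened below with their `variable` ∕ `open` ∕ `set_option` ∕ `universe` lines replayed verbatim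
from the tree, in order; the code after the replay block is the tree bytes :972–:1268, untouched except the (d1) cure named in PART 1.  HC_CM is proved only modulo the 7 printed citations (2 remaining: hLiu418 = stmt-HodgeConjecture-24832, h413 = stmt-HodgeConjecture-24833) until rung 0 closes; a re-home is count-neutral.
-/

-- ── replay of the scopes open at tree line :972 (verbatim) ──
set_option autoImplicit false
set_option linter.dupNamespace false
noncomputable section
namespace Summit.HodgeConjecture.HodgeConjecture.Cruxes.HLiu418.F0P6aLineSpecialisation


/-! ## §φ — §φ♭ `exists_roofFlat` — LA2-p03 (g3) `RoofFlat.v2` 8962b8836a3aba6a :400–:573 `section RoofFlat` (its §K prefix dropped) -/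

section Block_φ

open CategoryTheory CategoryTheory.Limits NumberField IsDedekindDomain MulAction AlgebraicGeometry
open scoped Matrix Pointwise MonObj
open Literature.NumberTheory.GaloisRepresentations
open Literature.NumberTheory.Automorphic Literature.NumberTheory.Automorphic.UnitaryGroup
open Literature.AlgebraicGeometry.ShimuraVarieties.UnitaryCanonicalModel
open Literature.NumberTheory.Automorphic.Liu2021.AppendixC
open Literature.AlgebraicGeometry.Motives (AlgPoints IntegralModel SchemeOver thickening thickeningLift specOver)
open Literature.NumberTheory.DiophantineGeometry (geomResidueField)
open Literature.AlgebraicGeometry.RelativeSpec (ActionOver)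
open Literature.NumberTheory.EllipticCurves (specGenericPoint)
open Literature.AlgebraicGeometry.AbelianSchemes Literature.AlgebraicGeometry.AbelianSchemes.AbelianSchemeOver
open Summit.HodgeConjecture.HodgeConjecture.Cruxes.HLiu418.F0P6aModuliDatumDefs
open Summit.HodgeConjecture.HodgeConjecture.Cruxes.HLiu418.F0P6aRGDAssembly
open Summit.HodgeConjecture.HodgeConjecture.Cruxes.HLiu418.F0P6aDatumOfInputs
open Summit.HodgeConjecture.HodgeConjecture.Cruxes.HLiu418.F0P6cHeckeBacktrack (exists_line_quotΩ_quotΩ_eq_translΩ_of_hecke_of_hyperspecial)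

section RoofFlat

-- the D-line `Letters` frame VERBATIM (upstairs only)
variable {F : Type} [Field F] [NumberField F] [IsCMField F] {ι₁ : F →+* ℂ}
    {Jstar : Matrix (Fin 2) (Fin 2) F}
    {K₀ : C5.OpenCompactSubgroup ↥(finAdelic ↥(maximalRealSubfield F) F (IsCMField.complexConj F) 2 Jstar)}
    {S : RecordSystemGS F Jstar ι₁ K₀} {hU7ₛ : S.HeckeTranslateDefinedOver}
    {hJ : (Jstar.map (IsCMField.complexConj F))ᵀ = Jstar} {hJu : IsUnit Jstar}
    {Fi : Type} [Field Fi] [Algebra F Fi] {Kc : C5.SmallLevel K₀} {G : Type} [Group G]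
    {𝓜 : IntegralModel (𝓞 F) F ((thickening F Fi).obj (S.M.obj Kc))}
    {w : HeightOneSpectrum (𝓞 F)} {hw : (IsCMField.complexConj F) • w ≠ w} {h𝓨 : (𝓜.localise w).IsSmoothProper 1}
    {θ : ActionOver (𝓜.localise w).total.hom ((Fi ≃ₐ[F] Fi) × G)}
    {e : Fi →ₐ[F] AlgebraicClosure (w.adicCompletion F)}

/-- **The level points `σᵃ(y) ∈ A_y(Ω̄)` of a tuple are `N`-torsion** (generic twin of ★ `lvlPt₀Of_pow_eq_one`: ★ `restrictPt_sectionPow_pow_card` on the generic fibre;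
`N = 0` is the trivial case `x ^ 0 = 1`). [cite: MumfordFogartyKirwan1994, Ch. 7 §2 Definition 7.1 (p. 129)] -/
theorem lvlPtΩOf_pow_eq_one (e₁ : Fi →ₐ[F] AlgebraicClosure (w.adicCompletion F))
    (𝒜 : AbelianSchemeOver (𝓜.localise w).total.left) {g N : ℕ} (lvl : 𝒜.LevelStructure g N)
    (y : AlgPoints (S.M.obj Kc) (AlgebraicClosure (w.adicCompletion F))) (a : Fin g ⊕ Fin g → ZMod N) :
    lvlPtΩOf S Kc 𝓜 w e₁ 𝒜 lvl y a ^ N = 1 := by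
  rcases Nat.eq_zero_or_pos N with h0 | hpos
  · have key : ∀ (n : ℕ) (x : (fibreΩOf S Kc 𝓜 w e₁ 𝒜 y).Points (AlgebraicClosure (w.adicCompletion F))), n = 0 → x ^ n = 1 :=
      fun n x h => h ▸ pow_zero x
    exact key N _ h0
  · haveI : NeZero N := ⟨hpos.ne'⟩
    exact (𝒜.baseChange (genΩ 𝓜 w)).restrictPt_sectionPow_pow_card (thickeningLift e₁ (S.M.obj Kc) y).left _
      (fun k => restrictPt_pow_eq_one _ _ ((lvl.baseChange _).pow_σ k)) a

set_option maxHeartbeats 400000 in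
/-- **(H4′-φ♭) ENGINE STEP `exists_roofFlat_aux`** — steps 2–5 of `exists_roofFlat` below over BOTH roofs OPENED: with roof₁ `A_y —q→ B ←c— A_{y″}` (the binders of
`exists_roofFlat` verbatim) and roof₀ `A_y —q₀→ B₂ ←c₀— A_{translΩ y}` (the fields of `hroof₂ y` that ★ `exists_flatLeg_of_roofs` consumes, `Ker q₀(Ω̄)` read through
`K₂`՚s clause) and the legs already known finite ∕ surjective (★ `roof_isogenies`, step 1 of the caller): the two primes are comaximal with the CRT element at `𝔭_w`
(`hunr`), the §K numbers of roof₁ (`K ⊆ A_y[𝔭_w𝔭_{c•w}]`, `#(K ∩ A_y[𝔭_w]) = q`, `#A_y[𝔭_w] = q·q`), `p·m ≡ 1 (N)` from `hpN`, then ★ `exists_flatLeg_of_roofs` — its OUTPUT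
returned LETTER FOR LETTER in the engine՚s token shapes at the fibres (`(actΩROf I ·).i a`, `(schΩOf …).toAffine.toAbelianVariety`-points).  Hoisted out of `exists_roofFlat` so that every declaration
stays ≤ 400 000 heartbeats after the rung-E re-home of the import cone; the statement of `exists_roofFlat` is unchanged.
[cite: Liu2021, Prop. D.8 (2)(3) p. 135, pp. 136–138] [cite: MumfordAV1970, §7 Thm. 4 (p. 72); §23 Thm. 2 (p. 231)] [cite: RapoportSmithlingZhang2020Diagonal, §4.3 (4.23) p. 21] -/
theorem exists_roofFlat_aux (I : RGDInputsAt F ι₁ Jstar K₀ S hU7ₛ hJ hJu Fi Kc G 𝓜 w hw h𝓨 θ e)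
    (quotΩ : ∀ y, LineOf I y → AlgPoints (S.M.obj Kc) (AlgebraicClosure (w.adicCompletion F)))
    (translΩ : AlgPoints (S.M.obj Kc) (AlgebraicClosure (w.adicCompletion F)) → AlgPoints (S.M.obj Kc) (AlgebraicClosure (w.adicCompletion F)))
    (hhecke : HeckeClause I quotΩ translΩ)
    (hunit : (UnitaryGroup.isUnit_placeForm Jstar hJu w).unit ∈ glInt 2 (w.adicCompletion F))
    (hKc : UnitaryGroup.IsHyperspecialAt ↥(maximalRealSubfield F) F (IsCMField.complexConj F) 2 Jstar Kc.1.1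
      (w.under (𝓞 ↥(maximalRealSubfield F))))
    (hroof : RoofLink I quotΩ) (hroof₂ : RoofLink₂ I translΩ)
    -- `p` unramified at `w` (= spine `I.hunr`) and prime to the level
    (hunr : ¬ w.asIdeal ^ 2 ∣ Ideal.span {((I.pChar : ℕ) : 𝓞 F)}) (hpN : Nat.Coprime I.pChar I.N)
    (y : AlgPoints (S.M.obj Kc) (AlgebraicClosure (w.adicCompletion F))) (L : LineOf I y)
    -- roof₁, OPENED (B-p08 (g35) §J.4 prefix VERBATIM)
    (K : Subgroup ((fibreΩOf S Kc 𝓜 w e I.univ y).Points (AlgebraicClosure (w.adicCompletion F))))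
    (hKL : ∀ P, P ∈ L.1 ↔ P ∈ K ∧ IsIdealTorsionΩ S Kc 𝓜 w e I.univ I.act y ((IsCMField.complexConj F) • w).asIdeal P)
    {B : AbelianSchemeOver (Spec (CommRingCat.of (AlgebraicClosure (w.adicCompletion F))))}
    (DB : B.DualPair) (lamB : B.X ⟶ DB.hat.X) [IsMonHom lamB]
    (hDB : Nonempty ((AlgebraicGeometry.Scheme.Modules.pullback DB.unitHatSlice).obj DB.P ≅ SheafOfModules.unit _))
    (q : (schΩOf S Kc 𝓜 w e I.univ y).X ⟶ B.X) [IsMonHom q]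
    (c : (schΩOf S Kc 𝓜 w e I.univ (quotΩ y L)).X ⟶ B.X) [IsMonHom c]
    (h1 : ∀ P : (fibreΩOf S Kc 𝓜 w e I.univ y).Points (AlgebraicClosure (w.adicCompletion F)),
      (AlgPoints.map q P : B.toAffine.toAbelianVariety.Points (AlgebraicClosure (w.adicCompletion F))) = 1 ↔ P ∈ K)
    (h2 : ∀ P : (fibreΩOf S Kc 𝓜 w e I.univ (quotΩ y L)).Points (AlgebraicClosure (w.adicCompletion F)),
      (AlgPoints.map c P : B.toAffine.toAbelianVariety.Points (AlgebraicClosure (w.adicCompletion F))) = 1 ↔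
        IsIdealTorsionΩ S Kc 𝓜 w e I.univ I.act (quotΩ y L) w.asIdeal P)
    (h2s : Function.Surjective c.left.base)
    (h3 : q ≫ lamB ≫ DualPair.dualIsogenyOver q (dualΩOf S Kc 𝓜 w e I.univ I.dual y) DB =
      (polΩOf S Kc 𝓜 w e I.univ I.pol y).lam ≫ (dualΩOf S Kc 𝓜 w e I.univ I.dual y).hat.mulN I.pChar)
    (h3'' : c ≫ lamB ≫ DualPair.dualIsogenyOver c (dualΩOf S Kc 𝓜 w e I.univ I.dual (quotΩ y L)) DB =
      (polΩOf S Kc 𝓜 w e I.univ I.pol (quotΩ y L)).lam ≫ (dualΩOf S Kc 𝓜 w e I.univ I.dual (quotΩ y L)).hat.mulN I.pChar)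
    (h4 : ∀ a : 𝓞 F, ∃ b : B.X ⟶ B.X,
      (actΩOf S Kc 𝓜 w e I.univ I.act a y).hom.hom.hom ≫ q = q ≫ b ∧ (actΩOf S Kc 𝓜 w e I.univ I.act a (quotΩ y L)).hom.hom.hom ≫ c = c ≫ b)
    (h5 : ∀ a : Fin I.g ⊕ Fin I.g → ZMod I.N,
      (AlgPoints.map q (lvlPtΩOf S Kc 𝓜 w e I.univ I.lvl y a) : B.toAffine.toAbelianVariety.Points (AlgebraicClosure (w.adicCompletion F))) =
        AlgPoints.map c (lvlPtΩOf S Kc 𝓜 w e I.univ I.lvl (quotΩ y L) a))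
    -- the image line in SUBGROUP currency (B-p08 (g35)'s `imgLineOfRoof I y (quotΩ y L) q c`, `fun _ => Iff.rfl`, (J1).1; ruling 09:28:58Z (1))
    (Lsub : Subgroup ((fibreΩOf S Kc 𝓜 w e I.univ (quotΩ y L)).Points (AlgebraicClosure (w.adicCompletion F))))
    (hLsub : ∀ P'' : (fibreΩOf S Kc 𝓜 w e I.univ (quotΩ y L)).Points (AlgebraicClosure (w.adicCompletion F)), P'' ∈ Lsub ↔
      (IsIdealTorsionΩ S Kc 𝓜 w e I.univ I.act (quotΩ y L) ((IsCMField.complexConj F) • w).asIdeal P'' ∧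
        ∃ P : (fibreΩOf S Kc 𝓜 w e I.univ y).Points (AlgebraicClosure (w.adicCompletion F)),
          IsIdealTorsionΩ S Kc 𝓜 w e I.univ I.act y ((IsCMField.complexConj F) • w).asIdeal P ∧
          (AlgPoints.map c P'' : B.toAffine.toAbelianVariety.Points (AlgebraicClosure (w.adicCompletion F))) = AlgPoints.map q P))
    (hcardL : Nat.card ↥Lsub = I.pChar ^ I.fDeg)
    -- roof₀ `A_y —q₀→ B₂ ←c₀— A_{translΩ y}`, OPENED (the fields of `hroof₂ y` the engine consumes; `Ker q₀(Ω̄) = A_y[𝔭_{c•w}]` through `K₂`'s clause)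
    {B₂ : AbelianSchemeOver (Spec (CommRingCat.of (AlgebraicClosure (w.adicCompletion F))))}
    (DB₂ : B₂.DualPair) (lamB₂ : B₂.X ⟶ DB₂.hat.X) [IsMonHom lamB₂]
    (hDB₂ : Nonempty ((AlgebraicGeometry.Scheme.Modules.pullback DB₂.unitHatSlice).obj DB₂.P ≅ SheafOfModules.unit _))
    (q₀ : (schΩOf S Kc 𝓜 w e I.univ y).X ⟶ B₂.X) [IsMonHom q₀]
    (c₀ : (schΩOf S Kc 𝓜 w e I.univ (translΩ y)).X ⟶ B₂.X) [IsMonHom c₀]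
    (h1₀ : ∀ P : (fibreΩOf S Kc 𝓜 w e I.univ y).Points (AlgebraicClosure (w.adicCompletion F)),
      (AlgPoints.map q₀ P : B₂.toAffine.toAbelianVariety.Points (AlgebraicClosure (w.adicCompletion F))) = 1 ↔
        IsIdealTorsionΩ S Kc 𝓜 w e I.univ I.act y ((IsCMField.complexConj F) • w).asIdeal P)
    (h3₀ : q₀ ≫ lamB₂ ≫ DualPair.dualIsogenyOver q₀ (dualΩOf S Kc 𝓜 w e I.univ I.dual y) DB₂ =
      (polΩOf S Kc 𝓜 w e I.univ I.pol y).lam ≫ (dualΩOf S Kc 𝓜 w e I.univ I.dual y).hat.mulN I.pChar)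
    (h4₀ : ∀ a : 𝓞 F, ∃ b : B₂.X ⟶ B₂.X,
      (actΩOf S Kc 𝓜 w e I.univ I.act a y).hom.hom.hom ≫ q₀ = q₀ ≫ b ∧ (actΩOf S Kc 𝓜 w e I.univ I.act a (translΩ y)).hom.hom.hom ≫ c₀ = c₀ ≫ b)
    (h5₀ : ∀ a : Fin I.g ⊕ Fin I.g → ZMod I.N,
      (AlgPoints.map q₀ (lvlPtΩOf S Kc 𝓜 w e I.univ I.lvl y a) : B₂.toAffine.toAbelianVariety.Points (AlgebraicClosure (w.adicCompletion F))) =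
        AlgPoints.map c₀ (lvlPtΩOf S Kc 𝓜 w e I.univ I.lvl (translΩ y) a))
    -- the legs are isogenies (step 1 of the caller, ★ `roof_isogenies`)
    [IsFinite q.left] [Surjective q.left] [IsFinite c.left] [IsFinite q₀.left] [Surjective q₀.left] :
    ∃ (φ : (schΩOf S Kc 𝓜 w e I.univ (quotΩ y L)).X ⟶ B₂.X) (_ : IsMonHom φ) (Kflat : Subgroup ((schΩOf S Kc 𝓜 w e I.univ (quotΩ y L)).toAffine.toAbelianVariety.Points (AlgebraicClosure (w.adicCompletion F)))),
      -- (r1♭) kernel of `φ♭` on `Ω`-points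
      (∀ P : (schΩOf S Kc 𝓜 w e I.univ (quotΩ y L)).toAffine.toAbelianVariety.Points (AlgebraicClosure (w.adicCompletion F)), (AlgPoints.map φ P : B₂.toAffine.toAbelianVariety.Points (AlgebraicClosure (w.adicCompletion F))) = 1 ↔ P ∈ Kflat) ∧
      -- (r3♭) similitude
      φ ≫ lamB₂ ≫ DualPair.dualIsogenyOver φ (dualΩOf S Kc 𝓜 w e I.univ I.dual (quotΩ y L)) DB₂ =
        (polΩOf S Kc 𝓜 w e I.univ I.pol (quotΩ y L)).lam ≫ (dualΩOf S Kc 𝓜 w e I.univ I.dual (quotΩ y L)).hat.mulN I.pChar ∧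
      -- (r4♭) common intertwiners with `c₀`
      (∀ a : 𝓞 F, ∃ b₀ : B₂.X ⟶ B₂.X, (actΩROf I (quotΩ y L)).i a ≫ φ = φ ≫ b₀ ∧ (actΩROf I (translΩ y)).i a ≫ c₀ = c₀ ≫ b₀) ∧
      -- (r5♭) level points
      (∀ i, (AlgPoints.map φ (lvlPtΩOf S Kc 𝓜 w e I.univ I.lvl (quotΩ y L) i) : B₂.toAffine.toAbelianVariety.Points (AlgebraicClosure (w.adicCompletion F))) = AlgPoints.map c₀ (lvlPtΩOf S Kc 𝓜 w e I.univ I.lvl (translΩ y) i)) ∧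
      -- `K♭ ⊆ A″[𝔭𝔭′]`, `ι″`-stable
      (∀ P ∈ Kflat, ∀ a ∈ w.asIdeal * ((IsCMField.complexConj F) • w).asIdeal, (AlgPoints.map ((actΩROf I (quotΩ y L)).i a) P : (schΩOf S Kc 𝓜 w e I.univ (quotΩ y L)).toAffine.toAbelianVariety.Points (AlgebraicClosure (w.adicCompletion F))) = 1) ∧
      (∀ a : 𝓞 F, ∀ P ∈ Kflat, (AlgPoints.map ((actΩROf I (quotΩ y L)).i a) P : (schΩOf S Kc 𝓜 w e I.univ (quotΩ y L)).toAffine.toAbelianVariety.Points (AlgebraicClosure (w.adicCompletion F))) ∈ Kflat) ∧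
      -- (V♭) the `𝔭′`-block of `K♭` is the image line
      (∀ P'' : (schΩOf S Kc 𝓜 w e I.univ (quotΩ y L)).toAffine.toAbelianVariety.Points (AlgebraicClosure (w.adicCompletion F)),
        (P'' ∈ Kflat ∧ ∀ a ∈ ((IsCMField.complexConj F) • w).asIdeal, (AlgPoints.map ((actΩROf I (quotΩ y L)).i a) P'' : (schΩOf S Kc 𝓜 w e I.univ (quotΩ y L)).toAffine.toAbelianVariety.Points (AlgebraicClosure (w.adicCompletion F))) = 1) ↔
          ((∀ a ∈ ((IsCMField.complexConj F) • w).asIdeal, (AlgPoints.map ((actΩROf I (quotΩ y L)).i a) P'' : (schΩOf S Kc 𝓜 w e I.univ (quotΩ y L)).toAffine.toAbelianVariety.Points (AlgebraicClosure (w.adicCompletion F))) = 1) ∧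
            ∃ P : (schΩOf S Kc 𝓜 w e I.univ y).toAffine.toAbelianVariety.Points (AlgebraicClosure (w.adicCompletion F)), (∀ a ∈ ((IsCMField.complexConj F) • w).asIdeal, (AlgPoints.map ((actΩROf I y).i a) P : (schΩOf S Kc 𝓜 w e I.univ y).toAffine.toAbelianVariety.Points (AlgebraicClosure (w.adicCompletion F))) = 1) ∧
              (AlgPoints.map c P'' : B.toAffine.toAbelianVariety.Points (AlgebraicClosure (w.adicCompletion F))) = AlgPoints.map q P)) ∧
      -- (W♭) the `𝔭`-block of `K♭` is `{x^p | c x ∈ q(A[𝔭])}`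
      (∀ P'' : (schΩOf S Kc 𝓜 w e I.univ (quotΩ y L)).toAffine.toAbelianVariety.Points (AlgebraicClosure (w.adicCompletion F)),
        (P'' ∈ Kflat ∧ ∀ a ∈ w.asIdeal, (AlgPoints.map ((actΩROf I (quotΩ y L)).i a) P'' : (schΩOf S Kc 𝓜 w e I.univ (quotΩ y L)).toAffine.toAbelianVariety.Points (AlgebraicClosure (w.adicCompletion F))) = 1) ↔
          ∃ R : (schΩOf S Kc 𝓜 w e I.univ y).toAffine.toAbelianVariety.Points (AlgebraicClosure (w.adicCompletion F)), (∀ a ∈ w.asIdeal, (AlgPoints.map ((actΩROf I y).i a) R : (schΩOf S Kc 𝓜 w e I.univ y).toAffine.toAbelianVariety.Points (AlgebraicClosure (w.adicCompletion F))) = 1) ∧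
            ∃ x : (schΩOf S Kc 𝓜 w e I.univ (quotΩ y L)).toAffine.toAbelianVariety.Points (AlgebraicClosure (w.adicCompletion F)),
              (AlgPoints.map c x : B.toAffine.toAbelianVariety.Points (AlgebraicClosure (w.adicCompletion F))) = AlgPoints.map q R ∧ P'' = x ^ I.pChar) ∧
      -- (COUNT)
      Nat.card ↥Kflat = I.pChar ^ I.fDeg * I.pChar ^ I.fDeg := by
  have hp0 : I.pChar ≠ 0 := I.hpChar.1.ne_zero
  -- ===================== 2. THE TWO PRIMES: comaximal; the CRT element at `𝔭_w` (`hunr`); `𝔭_{c•w} ⊆ 𝔭_{c•w}² + (p)` (`hunr′`) =====================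
  have hne : w.asIdeal ≠ ((IsCMField.complexConj F) • w).asIdeal := fun h => hw (HeightOneSpectrum.ext h.symm)
  have h𝔭𝔮 : w.asIdeal ⊔ ((IsCMField.complexConj F) • w).asIdeal = ⊤ :=
    Ideal.IsMaximal.coprime_of_ne w.isMaximal ((IsCMField.complexConj F) • w).isMaximal hne
  have hp𝔭 : ((I.pChar : ℕ) : 𝓞 F) ∈ w.asIdeal := I.hpChar.2
  have hp𝔮 : ((I.pChar : ℕ) : 𝓞 F) ∈ ((IsCMField.complexConj F) • w).asIdeal := I.hpCharConj
  obtain ⟨ε, hε1, hε2, hε3'⟩ := exists_crt_of_not_sq_dvd_span w.isMaximal hp𝔭 hunr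
  have hε3 : ε ∈ ((IsCMField.complexConj F) • w).asIdeal :=
    hε3' _ ((IsCMField.complexConj F) • w).isMaximal.isPrime hp𝔮 hne.symm
  have h𝔮unr : ((IsCMField.complexConj F) • w).asIdeal ≤
      ((IsCMField.complexConj F) • w).asIdeal ^ 2 ⊔ Ideal.span {((I.pChar : ℕ) : 𝓞 F)} :=
    le_sq_sup_span_of_not_sq_dvd_span ((IsCMField.complexConj F) • w).isMaximal hp𝔮 (not_sq_conj_dvd_span_of_not_sq_dvd_span w I.pChar hunr)
  -- ===================== 3. §K NUMBERS for roof₁: `K ⊆ A_y[𝔭_w𝔭_{c•w}]`, `#(K ∩ A_y[𝔭_w]) = q`, `#A_y[𝔭_w] = q·q` =====================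
  have hRoof : RoofΩ S Kc 𝓜 w e I.univ I.act I.dual I.pol I.lvl I.pChar w.asIdeal y (quotΩ y L) K :=
    ⟨B, DB, lamB, inferInstance, hDB, q, inferInstance, c, inferInstance, h1, h2, h2s, h3, h3'', h4, h5⟩
  have hKtors := isIdealTorsionΩ_mul_of_roofLink I quotΩ translΩ hhecke hunit hKc hroof hroof₂ hunr y L K ⟨hKL, hRoof⟩
  have hKw := natCard_roofKernel_inf_idealTorsionΩ_w_eq I quotΩ translΩ hhecke hunit hKc hroof hroof₂ hunr y L K ⟨hKL, hRoof⟩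
  have hAw : Nat.card {P : (fibreΩOf S Kc 𝓜 w e I.univ y).Points (AlgebraicClosure (w.adicCompletion F)) //
      IsIdealTorsionΩ S Kc 𝓜 w e I.univ I.act y w.asIdeal P} = I.pChar ^ I.fDeg * I.pChar ^ I.fDeg := by
    rw [← pow_add, ← two_mul]; exact natCard_idealTorsionΩ_w_eq I y
  -- ===================== 4. LEVEL: `p·m ≡ 1 (N)` from `hpN` =====================
  obtain ⟨m, hm⟩ : ∃ m : ℕ, I.pChar * m ≡ 1 [MOD I.N] := by
    rcases Nat.lt_or_ge 1 I.N with hN | hN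
    · obtain ⟨m, -, hm⟩ := Nat.exists_mul_mod_eq_one_of_coprime hpN hN
      exact ⟨m, by unfold Nat.ModEq; rw [hm, Nat.mod_eq_of_lt hN]⟩
    · rcases Nat.le_one_iff_eq_zero_or_eq_one.mp hN with h0 | h1
      · exfalso
        rw [h0, Nat.coprime_zero_right] at hpN
        exact I.hpChar.1.one_lt.ne' hpN
      · exact ⟨0, by rw [h1]; exact Nat.modEq_one⟩
  -- ===================== 5. THE ENGINE ★ `exists_flatLeg_of_roofs` and the repackaging =====================
  exact exists_flatLeg_of_roofs (actΩROf I y) (actΩROf I (quotΩ y L)) (actΩROf I (translΩ y)) q c q₀ c₀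
      w.asIdeal ((IsCMField.complexConj F) • w).asIdeal h𝔭𝔮 hp0 hp𝔭 hp𝔮 h𝔮unr ε hε1 hε2 hε3
      (dualΩOf S Kc 𝓜 w e I.univ I.dual y) (polΩOf S Kc 𝓜 w e I.univ I.pol y)
      (dualΩOf S Kc 𝓜 w e I.univ I.dual (quotΩ y L)) (polΩOf S Kc 𝓜 w e I.univ I.pol (quotΩ y L))
      DB lamB hDB DB₂ lamB₂ hDB₂ K hKtors h1 h2 h2s h3 h3'' h4 h1₀ h3₀ h4₀
      (lvlPtΩOf S Kc 𝓜 w e I.univ I.lvl y) (lvlPtΩOf S Kc 𝓜 w e I.univ I.lvl (quotΩ y L)) (lvlPtΩOf S Kc 𝓜 w e I.univ I.lvl (translΩ y))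
      h5 h5₀ (lvlPtΩOf_pow_eq_one e I.univ I.lvl (quotΩ y L)) (lvlPtΩOf_pow_eq_one e I.univ I.lvl (translΩ y)) m hm
      (pow_pos I.hpChar.1.pos _) hAw hKw Lsub hLsub hcardL

set_option maxHeartbeats 400000 in
/-- **(H4′-φ♭) `exists_roofFlat` — THE COMPARISON ROOF AT `y″ = quotΩ y L` LANDING ON `translΩ y`, WITH ITS KERNEL READ ON BOTH BLOCKS (statement first).**
Over the OPENED roof₁ `A_y —q→ B ←c— A_{y″}` (B-p08 (g35)'s §J.4 prefix VERBATIM) + `hunr` (`p` unramified at `w`; = `I.hunr`), `hpN` (`p ∤ N`) and `hcardL` (the image line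
has `q` points — B-p08's (J1) `imgLineOfRoof_isLine`, first conjunct): there is `K♭ ≤ A_{y″}(Ω̄)` with (a) `RoofΩ … (quotΩ y L) (translΩ y) K♭` (the roof `(φ♭, c₀)` into roof₀'s
middle), (b) (V♭) `K♭ ∩ A″[𝔭̄] =` the image line `imgLineOfRoof I y (quotΩ y L) q c` (its carrier text inlined), (c) (W♭) `K♭ ∩ A″[𝔭_w] = u(A_y[𝔭_w])` in the d-free reading
«`P″ = x″^p` with `c x″ = q R`, `R ∈ A_y[𝔭_w]`», (d) `Nat.card K♭ = q·q`.  After LA2-p04 (g2)'s (C6′-Ω) `roofKernel_eq_of_cw_eq`, `K♯ = K♭` for the roof♯ of `hroof (quotΩ y L) L♯`.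
[cite: Liu2021, Prop. D.8 (2)(3) p. 135, pp. 136–138] [cite: MumfordAV1970, §7 Thm. 4 (p. 72); §23 Thm. 2 (p. 231)] [cite: RapoportSmithlingZhang2020Diagonal, §4.3 (4.23) p. 21] -/
theorem exists_roofFlat (I : RGDInputsAt F ι₁ Jstar K₀ S hU7ₛ hJ hJu Fi Kc G 𝓜 w hw h𝓨 θ e)
    (quotΩ : ∀ y, LineOf I y → AlgPoints (S.M.obj Kc) (AlgebraicClosure (w.adicCompletion F)))
    (translΩ : AlgPoints (S.M.obj Kc) (AlgebraicClosure (w.adicCompletion F)) → AlgPoints (S.M.obj Kc) (AlgebraicClosure (w.adicCompletion F)))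
    (hhecke : HeckeClause I quotΩ translΩ)
    (hunit : (UnitaryGroup.isUnit_placeForm Jstar hJu w).unit ∈ glInt 2 (w.adicCompletion F))
    (hKc : UnitaryGroup.IsHyperspecialAt ↥(maximalRealSubfield F) F (IsCMField.complexConj F) 2 Jstar Kc.1.1
      (w.under (𝓞 ↥(maximalRealSubfield F))))
    (hroof : RoofLink I quotΩ) (hroof₂ : RoofLink₂ I translΩ)
    -- `p` unramified at `w` (= spine `I.hunr`) and prime to the level
    (hunr : ¬ w.asIdeal ^ 2 ∣ Ideal.span {((I.pChar : ℕ) : 𝓞 F)}) (hpN : Nat.Coprime I.pChar I.N)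
    (y : AlgPoints (S.M.obj Kc) (AlgebraicClosure (w.adicCompletion F))) (L : LineOf I y)
    -- roof₁, OPENED (B-p08 (g35) §J.4 prefix VERBATIM)
    (K : Subgroup ((fibreΩOf S Kc 𝓜 w e I.univ y).Points (AlgebraicClosure (w.adicCompletion F))))
    (hKL : ∀ P, P ∈ L.1 ↔ P ∈ K ∧ IsIdealTorsionΩ S Kc 𝓜 w e I.univ I.act y ((IsCMField.complexConj F) • w).asIdeal P)
    {B : AbelianSchemeOver (Spec (CommRingCat.of (AlgebraicClosure (w.adicCompletion F))))}
    (DB : B.DualPair) (lamB : B.X ⟶ DB.hat.X) [IsMonHom lamB]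
    (hDB : Nonempty ((AlgebraicGeometry.Scheme.Modules.pullback DB.unitHatSlice).obj DB.P ≅ SheafOfModules.unit _))
    (q : (schΩOf S Kc 𝓜 w e I.univ y).X ⟶ B.X) [IsMonHom q]
    (c : (schΩOf S Kc 𝓜 w e I.univ (quotΩ y L)).X ⟶ B.X) [IsMonHom c]
    (h1 : ∀ P : (fibreΩOf S Kc 𝓜 w e I.univ y).Points (AlgebraicClosure (w.adicCompletion F)),
      (AlgPoints.map q P : B.toAffine.toAbelianVariety.Points (AlgebraicClosure (w.adicCompletion F))) = 1 ↔ P ∈ K)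
    (h2 : ∀ P : (fibreΩOf S Kc 𝓜 w e I.univ (quotΩ y L)).Points (AlgebraicClosure (w.adicCompletion F)),
      (AlgPoints.map c P : B.toAffine.toAbelianVariety.Points (AlgebraicClosure (w.adicCompletion F))) = 1 ↔
        IsIdealTorsionΩ S Kc 𝓜 w e I.univ I.act (quotΩ y L) w.asIdeal P)
    (h2s : Function.Surjective c.left.base)
    (h3 : q ≫ lamB ≫ DualPair.dualIsogenyOver q (dualΩOf S Kc 𝓜 w e I.univ I.dual y) DB =
      (polΩOf S Kc 𝓜 w e I.univ I.pol y).lam ≫ (dualΩOf S Kc 𝓜 w e I.univ I.dual y).hat.mulN I.pChar)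
    (h3'' : c ≫ lamB ≫ DualPair.dualIsogenyOver c (dualΩOf S Kc 𝓜 w e I.univ I.dual (quotΩ y L)) DB =
      (polΩOf S Kc 𝓜 w e I.univ I.pol (quotΩ y L)).lam ≫ (dualΩOf S Kc 𝓜 w e I.univ I.dual (quotΩ y L)).hat.mulN I.pChar)
    (h4 : ∀ a : 𝓞 F, ∃ b : B.X ⟶ B.X,
      (actΩOf S Kc 𝓜 w e I.univ I.act a y).hom.hom.hom ≫ q = q ≫ b ∧ (actΩOf S Kc 𝓜 w e I.univ I.act a (quotΩ y L)).hom.hom.hom ≫ c = c ≫ b)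
    (h5 : ∀ a : Fin I.g ⊕ Fin I.g → ZMod I.N,
      (AlgPoints.map q (lvlPtΩOf S Kc 𝓜 w e I.univ I.lvl y a) : B.toAffine.toAbelianVariety.Points (AlgebraicClosure (w.adicCompletion F))) =
        AlgPoints.map c (lvlPtΩOf S Kc 𝓜 w e I.univ I.lvl (quotΩ y L) a))
    -- the image line in SUBGROUP currency (B-p08 (g35)'s `imgLineOfRoof I y (quotΩ y L) q c`, `fun _ => Iff.rfl`, (J1).1; ruling 09:28:58Z (1))
    (Lsub : Subgroup ((fibreΩOf S Kc 𝓜 w e I.univ (quotΩ y L)).Points (AlgebraicClosure (w.adicCompletion F))))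
    (hLsub : ∀ P'' : (fibreΩOf S Kc 𝓜 w e I.univ (quotΩ y L)).Points (AlgebraicClosure (w.adicCompletion F)), P'' ∈ Lsub ↔
      (IsIdealTorsionΩ S Kc 𝓜 w e I.univ I.act (quotΩ y L) ((IsCMField.complexConj F) • w).asIdeal P'' ∧
        ∃ P : (fibreΩOf S Kc 𝓜 w e I.univ y).Points (AlgebraicClosure (w.adicCompletion F)),
          IsIdealTorsionΩ S Kc 𝓜 w e I.univ I.act y ((IsCMField.complexConj F) • w).asIdeal P ∧
          (AlgPoints.map c P'' : B.toAffine.toAbelianVariety.Points (AlgebraicClosure (w.adicCompletion F))) = AlgPoints.map q P))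
    (hcardL : Nat.card ↥Lsub = I.pChar ^ I.fDeg) :
    ∃ Kflat : Subgroup ((fibreΩOf S Kc 𝓜 w e I.univ (quotΩ y L)).Points (AlgebraicClosure (w.adicCompletion F))),
      -- (a) THE COMPARISON ROOF `A_{y″} —φ♭→ B₂ ←c₀— A_{translΩ y}`
      RoofΩ S Kc 𝓜 w e I.univ I.act I.dual I.pol I.lvl I.pChar w.asIdeal (quotΩ y L) (translΩ y) Kflat ∧
      -- (b) (V♭) its kernel's `c•w`-part is the image line (B-p08's `imgLineOfRoof I y (quotΩ y L) q c`, carrier inlined)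
      (∀ P'' : (fibreΩOf S Kc 𝓜 w e I.univ (quotΩ y L)).Points (AlgebraicClosure (w.adicCompletion F)),
        (P'' ∈ Kflat ∧ IsIdealTorsionΩ S Kc 𝓜 w e I.univ I.act (quotΩ y L) ((IsCMField.complexConj F) • w).asIdeal P'') ↔
          (IsIdealTorsionΩ S Kc 𝓜 w e I.univ I.act (quotΩ y L) ((IsCMField.complexConj F) • w).asIdeal P'' ∧
            ∃ P : (fibreΩOf S Kc 𝓜 w e I.univ y).Points (AlgebraicClosure (w.adicCompletion F)),
              IsIdealTorsionΩ S Kc 𝓜 w e I.univ I.act y ((IsCMField.complexConj F) • w).asIdeal P ∧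
              (AlgPoints.map c P'' : B.toAffine.toAbelianVariety.Points (AlgebraicClosure (w.adicCompletion F))) = AlgPoints.map q P)) ∧
      -- (c) (W♭) its kernel's `w`-part is `u(A_y[𝔭_w])`, `u = q ≫ d` read d-free: `P″ = x″^p` for some `x″` over `q R`, `R ∈ A_y[𝔭_w]`
      (∀ P'' : (fibreΩOf S Kc 𝓜 w e I.univ (quotΩ y L)).Points (AlgebraicClosure (w.adicCompletion F)),
        (P'' ∈ Kflat ∧ IsIdealTorsionΩ S Kc 𝓜 w e I.univ I.act (quotΩ y L) w.asIdeal P'') ↔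
          ∃ R : (fibreΩOf S Kc 𝓜 w e I.univ y).Points (AlgebraicClosure (w.adicCompletion F)),
            IsIdealTorsionΩ S Kc 𝓜 w e I.univ I.act y w.asIdeal R ∧
            ∃ x'' : (fibreΩOf S Kc 𝓜 w e I.univ (quotΩ y L)).Points (AlgebraicClosure (w.adicCompletion F)),
              (AlgPoints.map c x'' : B.toAffine.toAbelianVariety.Points (AlgebraicClosure (w.adicCompletion F))) = AlgPoints.map q R ∧
              P'' = x'' ^ I.pChar) ∧
      -- (d) the kernel has `q·q` points
      Nat.card ↥Kflat = I.pChar ^ I.fDeg * I.pChar ^ I.fDeg := by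
  -- ===================== 0. OPEN roof₀ `A_y —q₀→ B₂ ←c₀— A_{translΩ y}` (`hroof₂ y`) =====================
  obtain ⟨K₂, hK₂, hR₀⟩ := hroof₂ y
  obtain ⟨B₂, DB₂, lamB₂, hlamB₂, hDB₂, q₀, hq₀, c₀, hc₀, h1₀, h2₀, h2s₀, h3₀, h3₀'', h4₀, h5₀⟩ := hR₀
  haveI := hlamB₂; haveI := hq₀; haveI := hc₀
  haveI hpolm := (polΩOf S Kc 𝓜 w e I.univ I.pol y).isMonHom
  haveI hpolm'' := (polΩOf S Kc 𝓜 w e I.univ I.pol (quotΩ y L)).isMonHom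
  haveI hpolmt := (polΩOf S Kc 𝓜 w e I.univ I.pol (translΩ y)).isMonHom
  have hD := (polΩOf S Kc 𝓜 w e I.univ I.pol y).nonempty_unitHatSlice_iso
  have hD'' := (polΩOf S Kc 𝓜 w e I.univ I.pol (quotΩ y L)).nonempty_unitHatSlice_iso
  have hDt := (polΩOf S Kc 𝓜 w e I.univ I.pol (translΩ y)).nonempty_unitHatSlice_iso
  -- ===================== 1. THE LEGS ARE ISOGENIES (★ `roof_isogenies` ×2; (P-1) at the three fibres by §K `polQuasiInvΩ`) =====================
  have hp0 : I.pChar ≠ 0 := I.hpChar.1.ne_zero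
  obtain ⟨d₁, ν₁, hν₁, hcop₁, hν₁eq⟩ := polQuasiInvΩ I y
  obtain ⟨d₂, ν₂, hν₂, hcop₂, hν₂eq⟩ := polQuasiInvΩ I (quotΩ y L)
  obtain ⟨d₃, ν₃, hν₃, hcop₃, hν₃eq⟩ := polQuasiInvΩ I (translΩ y)
  haveI := hν₁; haveI := hν₂; haveI := hν₃
  have hdne : ∀ {d : ℕ}, I.pChar.Coprime d → (d : AlgebraicClosure (w.adicCompletion F)) ≠ 0 := fun {d} hd => by
    have hd0 : d ≠ 0 := by
      rintro rfl
      exact I.hpChar.1.ne_one ((Nat.coprime_zero_right _).mp hd)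
    exact_mod_cast hd0
  obtain ⟨hqI, hcI, -, -, -⟩ := roof_isogenies (isOfRelDim_schΩOf I y) (isOfRelDim_schΩOf I (quotΩ y L)) q c
    (dualΩOf S Kc 𝓜 w e I.univ I.dual y) (dualΩOf S Kc 𝓜 w e I.univ I.dual (quotΩ y L)) DB hD hD'' hDB
    (polΩOf S Kc 𝓜 w e I.univ I.pol y).lam (polΩOf S Kc 𝓜 w e I.univ I.pol (quotΩ y L)).lam lamB hp0 h2s h3 h3''
    (hdne hcop₁) ν₁ hν₁eq (hdne hcop₂) ν₂ hν₂eq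
  obtain ⟨hq₀I, -, -, -, -⟩ := roof_isogenies (isOfRelDim_schΩOf I y) (isOfRelDim_schΩOf I (translΩ y)) q₀ c₀
    (dualΩOf S Kc 𝓜 w e I.univ I.dual y) (dualΩOf S Kc 𝓜 w e I.univ I.dual (translΩ y)) DB₂ hD hDt hDB₂
    (polΩOf S Kc 𝓜 w e I.univ I.pol y).lam (polΩOf S Kc 𝓜 w e I.univ I.pol (translΩ y)).lam lamB₂ hp0 h2s₀ h3₀ h3₀''
    (hdne hcop₁) ν₁ hν₁eq (hdne hcop₃) ν₃ hν₃eq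
  haveI : Surjective q.left := hqI.1
  haveI : IsFinite q.left := hqI.2
  haveI : IsFinite c.left := hcI.2
  haveI : Surjective q₀.left := hq₀I.1
  haveI : IsFinite q₀.left := hq₀I.2
  -- ===================== 2.–5. BY NAME: comaximal primes + CRT, §K numbers, level, ★ `exists_flatLeg_of_roofs` (`exists_roofFlat_aux`) =====================
  obtain ⟨φ, hφ, Kflat, hr1, hr3, hr4, hr5, -, -, hV, hW, hcount⟩ :=
    exists_roofFlat_aux I quotΩ translΩ hhecke hunit hKc hroof hroof₂ hunr hpN y L K hKL DB lamB hDB q c h1 h2 h2s h3 h3'' h4 h5 Lsub hLsub hcardL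
      DB₂ lamB₂ hDB₂ q₀ c₀ (fun P => (h1₀ P).trans (hK₂ P)) h3₀ h4₀ h5₀
  exact ⟨Kflat, ⟨B₂, DB₂, lamB₂, hlamB₂, hDB₂, φ, hφ, c₀, hc₀, hr1, h2₀, h2s₀, hr3, h3₀'', hr4, hr5⟩, hV, hW, hcount⟩

end RoofFlat

end Block_φ

end Summit.HodgeConjecture.HodgeConjecture.Cruxes.HLiu418.F0P6aLineSpecialisation

end
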